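import Summits.QuantumFields.YangMills.Theses.TransverseWardBL
import Summits.QuantumFields.YangMills.Theorems.TransverseWardBLBoxHodgeSplitCodiff
import Summits.QuantumFields.YangMills.Theorems.TransverseWardBLBoxHodgeSplitGreen
import Summits.QuantumFields.YangMills.Theorems.TransverseWardBLWardPinning
import HarnessLib

/-!
# Route `TransverseWardBL`, support `BoxHodgeSplit` (stmt-QuantumFields-22932): the exact Hodge split of the box form

For the box 2-form `h = h_(N,M)` on the torus `(ℤ/(M+1))⁴` (`h(y;0,1) = #{x ∈ B_N : x ≡ y}`, other orientations `0`) we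
exhibit, for EVERY `N` and every `M ≥ M₀(N, ε)`, a real 1-cochain `α` and a 2-cochain `u ⟂ im d` with `h = dα + u`,
`|dα|² ≤ (1/2+ε)#B_N`, `|u|² ≤ (1/2+ε)#B_N` — in closed form, with no Fourier limit:

* `α = ψ_g = d*(g ⊗ e₀∧e₁)` (the tree's `testForm g`) for the box potential `g = ½∑_{x∈B_N} G̃(· − x̄)`, `G̃ = torusGreen`
  (`−ΔG̃ = 2(δ₀ − L⁻⁴)`), and `u = h − dα`;
* `d*u = 0` (`coclosed_boxRemainder`: `d*dψ_g = d*((−Δg) ⊗ e₀∧e₁) = d*h`);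
* `|dα|² = ⟨dα, h⟩ = ∑_y c(y)(−Δ₀−Δ₁)g(y) = (#B_N − #B_N²/L⁴)/2` by the `(01)↔(23)` swap symmetry of `G̃` and of the cube
  (`boxWeight_secondDiff01_sum`), and `|u|² = |h|² − |dα|² = #B_N/2 + #B_N²/(2L⁴) ≤ (1/2+ε)#B_N` once `L = M+1 > 2N` and
  `2εL⁴ ≥ #B_N` (`M₀ = 2N + 1 + ⌈#B_N/(2ε)⌉`).

Free-hands width seat `ym-t4-w11` (cell ym-fleet) for planner ym-idea-4 g9 (LINE g9-A).  THEOREMS ONLY; lattice Hodge theory for the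
abelian comparison line — nothing about the Yang–Mills mass gap is proved.

References: J. Fröhlich, T. Spencer, Comm. Math. Phys. **83** (1982) 411, §2 [FrohlichSpencer1982]; A. Guth, Phys. Rev. D **21** (1980)
2291 [Guth1980].
-/

set_option autoImplicit false

noncomputable section

open Finset
open scoped BigOperators
open Literature.Probability.LatticeModels (Torus.proj box mem_box torusGreen)
open Literature.MathematicalPhysics.QuantumFieldTheory Literature.MathematicalPhysics.QuantumLattice
open Summit.QuantumFields.YangMills.Theorems.U1DipoleHelicity

namespace Summit.QuantumFields.YangMills.Theorems.TransverseWardBL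

/-- The size condition: for `M ≥ 2N + 1 + ⌈#B_N/(2ε)⌉`, `#B_N ≤ 2ε(M+1)⁴`. [folklore] -/
theorem card_box_le_of_le {ε : ℝ} (hε : 0 < ε) {N M : ℕ} (hM : 2 * N + 1 + ⌈((box 4 N).card : ℝ) / (2 * ε)⌉₊ ≤ M) :
    ((box 4 N).card : ℝ) ≤ 2 * ε * ((M + 1 : ℕ) : ℝ) ^ 4 := by
  have h1 : (⌈((box 4 N).card : ℝ) / (2 * ε)⌉₊ : ℝ) ≤ (M : ℝ) := by
    exact_mod_cast le_trans (Nat.le_add_left _ _) hM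
  have h2 : ((box 4 N).card : ℝ) / (2 * ε) ≤ (M : ℝ) := (Nat.le_ceil _).trans h1
  rw [div_le_iff₀ (by positivity)] at h2
  have h3 : (M : ℝ) ≤ ((M + 1 : ℕ) : ℝ) ^ 4 := by
    have h4 : ((M + 1 : ℕ) : ℝ) ≤ ((M + 1 : ℕ) : ℝ) ^ 4 :=
      le_self_pow₀ (by exact_mod_cast Nat.succ_le_succ (Nat.zero_le M)) (by norm_num)
    push_cast at h4 ⊢
    linarith
  nlinarith

/-- **`BoxHodgeSplit`** (item stmt-QuantumFields-22932), BY NAME. [cite: FrohlichSpencer1982, §2] -/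
theorem boxHodgeSplit_proof : Summit.QuantumFields.YangMills.Theses.TransverseWardBL.BoxHodgeSplit := by
  unfold Summit.QuantumFields.YangMills.Theses.TransverseWardBL.BoxHodgeSplit
  intro ε hε
  refine ⟨0, fun N _ => ?_⟩
  refine ⟨2 * N + 1 + ⌈((box 4 N).card : ℝ) / (2 * ε)⌉₊, fun M hM => ?_⟩
  have hL : 2 * N < M + 1 := by
    have : 2 * N + 1 ≤ M := le_trans (Nat.le_add_right _ _) hM
    omega
  have hLε : ((box 4 N).card : ℝ) ≤ 2 * ε * ((M + 1 : ℕ) : ℝ) ^ 4 := card_box_le_of_le hε hM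
  -- the box potential and the two witnesses
  set g : Site 4 (M + 1) → ℝ := fun y => 1 / 2 * ∑ x ∈ box 4 N, torusGreen (y - Torus.proj (M + 1) x) with hgdef
  have hg : ∀ y : Site 4 (M + 1), g y = 1 / 2 * ∑ x ∈ box 4 N, torusGreen (y - Torus.proj (M + 1) x) := fun y => rfl
  refine ⟨fun y k => testForm g (y, k),
    fun p => (if p.2.1 = ((0 : Fin 4), (1 : Fin 4)) then
        (((box 4 N).filter (fun x => (fun i => ((x i : ℤ) : ZMod (M + 1))) = p.1)).card : ℝ) else 0) -
      rplaqCharge (testForm g) p.1 p.2.1.1 p.2.1.2, ?_⟩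
  -- names for the three cochains
  set hF : Plaquette 4 (M + 1) → ℝ := fun p => if p.2.1 = ((0 : Fin 4), (1 : Fin 4)) then
      (((box 4 N).filter (fun x => (fun i => ((x i : ℤ) : ZMod (M + 1))) = p.1)).card : ℝ) else 0 with hhF
  set nF : Plaquette 4 (M + 1) → ℝ := fun p => rplaqCharge (testForm g) p.1 p.2.1.1 p.2.1.2 with hnF
  have hres : ∀ p : Plaquette 4 (M + 1),
      LatticeForm.res (LatticeForm.td₁ (fun (y : Site 4 (M + 1)) (k : Fin 4) => testForm g (y, k))) p = nF p :=
    fun p => rfl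
  -- the Poisson equation and co-closedness of `u = h − dα`
  have hP : ∀ y : Site 4 (M + 1), ∑ μ : Fin 4, (2 * g y - g (y + Pi.single μ 1) - g (y - Pi.single μ 1)) =
      (fun y : Site 4 (M + 1) =>
          ((((box 4 N).filter (fun x => (fun i => ((x i : ℤ) : ZMod (M + 1))) = y)).card : ℝ))) y -
        ((box 4 N).card : ℝ) / ((M + 1 : ℕ) : ℝ) ^ 4 :=
    fun y => poisson_boxPotential N g hg y
  have hco : ∀ e : Edge 4 (M + 1), ∑ p : Plaquette 4 (M + 1), (hF p - nF p) *
      LatticeForm.res (LatticeForm.td₁ (fun (y : Site 4 (M + 1)) (k : Fin 4) => if y = e.1 ∧ k = e.2 then (1 : ℝ) else 0)) p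
        = 0 :=
    fun e => coclosed_boxRemainder g _ _ hP e
  -- orthogonality `⟨u, dα⟩ = 0` and the norm bookkeeping
  have horth : ∑ p : Plaquette 4 (M + 1), (hF p - nF p) * nF p = 0 := by
    have h := sum_mul_res_td₁_eq_zero hco (fun (y : Site 4 (M + 1)) (k : Fin 4) => testForm g (y, k))
    simpa only [hres] using h
  have hnorms := norms_of_orthogonal_split hF nF (fun p => hF p - nF p) (fun p => rfl) horth
  -- `⟨dα, h⟩ = (#B − #B²/L⁴)/2` and `|h|² = #B`
  have hext_n : ∀ y : Site 4 (M + 1), LatticeForm.ext nF y 0 1 =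
      (2 * g y - g (y + Pi.single 0 1) - g (y - Pi.single 0 1)) + (2 * g y - g (y + Pi.single 1 1) - g (y - Pi.single 1 1)) := by
    intro y
    rw [hnF, ext_rplaqCharge_testForm g _ (show (0 : Fin 4) < 1 by decide), rplaqCharge_testForm_zero_one]
  have hext_h : ∀ y : Site 4 (M + 1), LatticeForm.ext hF y 0 1 =
      (((box 4 N).filter (fun x => (fun i => ((x i : ℤ) : ZMod (M + 1))) = y)).card : ℝ) := by
    intro y
    rw [hhF, LatticeForm.ext_apply_of_lt _ _ (show (0 : Fin 4) < 1 by decide)]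
    simp
  have hS : ∑ p : Plaquette 4 (M + 1), nF p * hF p =
      (((box 4 N).card : ℝ) - ((box 4 N).card : ℝ) ^ 2 / ((M + 1 : ℕ) : ℝ) ^ 4) / 2 := by
    have h1 : ∑ p : Plaquette 4 (M + 1), nF p * hF p =
        ∑ p : Plaquette 4 (M + 1), (if p.2.1 = ((0 : Fin 4), (1 : Fin 4)) then
          (fun y : Site 4 (M + 1) => ((((box 4 N).filter (fun x => (fun i => ((x i : ℤ) : ZMod (M + 1))) = y)).card : ℝ)))
            p.1 else 0) * nF p :=
      Finset.sum_congr rfl fun p _ => by rw [mul_comm]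
    have h2 : ∑ y : Site 4 (M + 1), (((box 4 N).filter (fun x => Torus.proj (M + 1) x = y)).card : ℝ) *
        ((2 * g y - g (y + Pi.single 0 1) - g (y - Pi.single 0 1)) + (2 * g y - g (y + Pi.single 1 1) - g (y - Pi.single 1 1))) =
        (((box 4 N).card : ℝ) - ((box 4 N).card : ℝ) ^ 2 / ((M + 1 : ℕ) : ℝ) ^ 4) / 2 :=
      boxWeight_secondDiff01_sum hL g hg
    rw [h1, sum_boxForm_mul
      (fun y : Site 4 (M + 1) => ((((box 4 N).filter (fun x => (fun i => ((x i : ℤ) : ZMod (M + 1))) = y)).card : ℝ))) nF,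
      ← h2]
    refine Finset.sum_congr rfl fun y _ => ?_
    rw [hext_n]
    rfl
  have hH : ∑ p : Plaquette 4 (M + 1), hF p ^ 2 = ((box 4 N).card : ℝ) := by
    have h1 : ∑ p : Plaquette 4 (M + 1), hF p ^ 2 =
        ∑ p : Plaquette 4 (M + 1), (if p.2.1 = ((0 : Fin 4), (1 : Fin 4)) then
          (fun y : Site 4 (M + 1) => ((((box 4 N).filter (fun x => (fun i => ((x i : ℤ) : ZMod (M + 1))) = y)).card : ℝ)))
            p.1 else 0) * hF p :=
      Finset.sum_congr rfl fun p _ => by rw [sq]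
    have h2 : ∑ y : Site 4 (M + 1), (((box 4 N).filter (fun x => Torus.proj (M + 1) x = y)).card : ℝ) ^ 2 =
        ((box 4 N).card : ℝ) := sum_boxWeight_sq hL
    rw [h1, sum_boxForm_mul
      (fun y : Site 4 (M + 1) => ((((box 4 N).filter (fun x => (fun i => ((x i : ℤ) : ZMod (M + 1))) = y)).card : ℝ))) hF,
      ← h2]
    refine Finset.sum_congr rfl fun y _ => ?_
    rw [hext_h, sq]
    rfl
  -- numerics
  have hB0 : 0 ≤ ((box 4 N).card : ℝ) := Nat.cast_nonneg _
  have hL4 : 0 < ((M + 1 : ℕ) : ℝ) ^ 4 := by positivity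
  have hsq0 : 0 ≤ ((box 4 N).card : ℝ) ^ 2 / ((M + 1 : ℕ) : ℝ) ^ 4 := by positivity
  have hkey : ((box 4 N).card : ℝ) ^ 2 / ((M + 1 : ℕ) : ℝ) ^ 4 ≤ 2 * ε * ((box 4 N).card : ℝ) := by
    rw [div_le_iff₀ hL4]
    nlinarith [hLε, hB0]
  refine ⟨fun p => ?_, fun e => ?_, ?_, ?_⟩
  · -- h = dα + u
    rw [hres]
    ring
  · -- d*u = 0
    exact hco e
  · -- |dα|² ≤ (1/2 + ε) #B
    simp only [hres]
    rw [hnorms.1, hS]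
    nlinarith [hB0, hsq0, hε]
  · -- |u|² ≤ (1/2 + ε) #B
    have hu : ∑ p : Plaquette 4 (M + 1), (hF p - nF p) ^ 2 =
        ((box 4 N).card : ℝ) - (((box 4 N).card : ℝ) - ((box 4 N).card : ℝ) ^ 2 / ((M + 1 : ℕ) : ℝ) ^ 4) / 2 := by
      rw [hnorms.2, hH, hS]
    simp only [hhF, hnF] at hu
    simp only
    rw [hu]
    nlinarith [hkey, hB0]

end Summit.QuantumFields.YangMills.Theorems.TransverseWardBL

end
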